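import Literature.Computability.AlgebraicComplexity.MS2001ClassVarieties
import HarnessLib

/-!
# GCT I §4.2, the Tutte-matrix device: the minimum-weight part of the determinant lies in
# `Δ[det]` — PROOF

Topic `Computability/AlgebraicComplexity`. Cell `val-lit`, row MS2001-A (K. Mulmuley, M. Sohoni,
*Geometric complexity theory I*, SIAM J. Comput. 31 (2001) 496–526), §4.2, typed from the
AUTHORS' VERSION (AV; text of record `HOME/bip/texts/MS2001-authorversion/`, locators «AV p.N,
all.txt Lnnnn»). Companion of `MS2001ClassVarieties.lean` §4.2 (the `lim_{t→0}` device
`map_eval_zero_mem_orbitClosure_of_family`) and of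
`Literature/LinearAlgebra/Matrix/SkewDetEvenCycles.lean` (eq. (6)). Theorems and bodied
definitions only: no named facts, no instances, no `sorry`.

## The source (AV pp.17–18, all.txt L1226–1262)

> "Construct a modified Tutte matrix `M̃` by replacing every variable `y_{ij}`, if it indeed
> occurs in `M`, by `t^{w_{ij}} y_{ij}`, where `t` is an indeterminate parameter and `w_{ij}` is
> the weight of the edge joining the nodes `i` and `j`. In other words, `M̃ = α(t)(M)`, where
> `α(t)` is the one parameter subgroup that maps such `y_{ij}` to `t^{w_{ij}} y_{ij}`. […] Then
> eq.(6) implies that `D(Y) = det(M̃) = t^{2W} h(Y) +` higher order terms in `t`, where `W` is the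
> weight of a minimum-weight perfect matching in `G` and `h(Y) = ∑_σ sign(σ) wt(σ)`, where `σ`
> ranges over all permutations with nonzero weight whose cycle graphs can be decomposed as the
> union of two minimum-weight perfect matchings […]. Clearly `D(Y) = det(M̃)` belongs to the
> projective orbit closure `Δ[det(Y)]` for every `t`. Projectively, `D(Y)` is equal to `h(Y)`
> plus higher order terms in `t`. Since, `h(Y) = lim_{t→0} t^{-2W} D(Y)`, in the projective space
> `P(V)`, we have `h(Y) = lim_{t→0} D(Y) = lim_{t→0} det(α(t)M)`. In other words, `h(Y)` belongs
> to the projective closure `Δ[det(Y)]`."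

## Contents — the device for the determinant itself (any weights, any infinite field)

For integer weights `w_{ij} ≥ 0` on the entries of the `m × m` variable matrix `Y` and the
one-parameter subgroup `α(t) : y_{ij} ↦ t^{w_{ij}} y_{ij}`:
* `MS2001Sec42.permWeight w σ = ∑_i w_{σ(i), i}` (the weight of the permutation term of `σ`),
  `MS2001Sec42.minPermWeight w = W₀` (its minimum), `MS2001Sec42.permTerm σ =
  sign(σ) ∏_i y_{σ(i), i}`, and the INITIAL FORM `MS2001Sec42.detInitialForm k m w =
  ∑_{wt(σ) = W₀} sign(σ) ∏_i y_{σ(i), i}` (the print's `h(Y)`, before the Tutte specialisation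
  `y_{ji} = -y_{ij}`).
* `linSubst_weightScaling_detPoly` — **"`D(Y) = det(α(t) Y) = t^{W₀} h(Y) +` higher order terms"**:
  `α(t) · det = ∑_σ t^{wt(σ)} sign(σ) ∏_i y_{σ(i), i}`.
* **`MS2001_sec_4_2_detInitialForm_mem_orbitClosure`** — **"`h(Y) = lim_{t→0} t^{-W₀} D(Y)`
  belongs to `Δ[det(Y)]`"**: the initial form lies in the orbit closure of `det_m`, over every
  infinite field. Proof as printed: for `t ≠ 0`, `t^{-W₀} · (α(t) · det)` is the point
  `β(t) · det` of the `GL`-orbit with `β(t) = α(t)` followed by scaling the variables of one row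
  by `t^{-W₀}`; the family is polynomial in `t` and its value at `t = 0` is `h(Y)`
  (`map_eval_zero_mem_orbitClosure_of_family`).

## Rendering (disclosed)

* The print works with the Tutte matrix of a weighted graph (`y_{ji} = -y_{ij}`, zero pattern,
  `W₀ = 2W` with `W` the minimum weight of a perfect matching by eq. (6)); typed here is the
  device for the determinant with ARBITRARY entry weights, of which the Tutte case is the
  specialisation along the substitution `y_{ji} ↦ -y_{ij}`, `y_{ij} ↦ 0` off the graph (a linear
  substitution, under which `Δ[det]`-membership of the family persists). The identification of
  the minimum-weight permutations with pairs of minimum-weight perfect matchings (via eq. (6),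
  `Literature/LinearAlgebra/Matrix/SkewDetEvenCycles.lean`) and the conjecture that `h(Y)` is an
  exterior point for suitable graphs are NOT typed.
* `Δ[det] = orbitClosure (detPoly (Fin m) k)` (affine `GL`-orbit closure, the tree's reading of
  the projective closure; the scalar `t^{-W₀}` is absorbed into `GL` by a row scaling).

Honest framing: literature typing; nothing here bears on any separation (`VP ≠ VNP` NOT proved).

## References

* [MulmuleySohoniSIAM2001] K. Mulmuley, M. Sohoni, *Geometric complexity theory I*, SIAM J.
  Comput. 31 (2001) 496–526, §4.2 (AV pp.17–18, all.txt L1226–1262).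
-/

noncomputable section

open MvPolynomial

namespace Literature.Computability.AlgebraicComplexity

universe u

section InitialForm

variable (m : ℕ) (w : Fin m × Fin m → ℕ)

/-- The weight `wt(σ) = ∑_i w_{σ(i), i}` of the permutation term of `σ` under the scaling
`y_{ij} ↦ t^{w_{ij}} y_{ij}`. [cite: MulmuleySohoniSIAM2001, §4.2 (AV p.17, all.txt L1226–1241)] -/
def MS2001Sec42.permWeight (σ : Equiv.Perm (Fin m)) : ℕ := ∑ i, w (σ i, i)

/-- The minimum weight `W₀` of a permutation term (the print's `2W`).
[cite: MulmuleySohoniSIAM2001, §4.2 (AV p.18, all.txt L1243)] -/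
def MS2001Sec42.minPermWeight : ℕ :=
  Finset.univ.inf' Finset.univ_nonempty (MS2001Sec42.permWeight m w)

variable (R : Type u) [CommRing R]

/-- The signed permutation monomial `sign(σ) ∏_i y_{σ(i), i}` of the Leibniz expansion.
[cite: MulmuleySohoniSIAM2001, §4.2 (AV p.17, all.txt L1190–1194)] -/
def MS2001Sec42.permTerm (σ : Equiv.Perm (Fin m)) : MvPolynomial (Fin m × Fin m) R :=
  ((Equiv.Perm.sign σ : ℤ) : MvPolynomial (Fin m × Fin m) R) * ∏ i, X (σ i, i)

/-- The INITIAL FORM of the determinant for the weights `w`: the sum of the Leibniz terms of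
minimum weight (the print's `h(Y) = lim_{t→0} t^{-2W} det(α(t)Y)`).
[cite: MulmuleySohoniSIAM2001, §4.2 (AV p.18, all.txt L1243–1249)] -/
def MS2001Sec42.detInitialForm : MvPolynomial (Fin m × Fin m) R :=
  ∑ σ ∈ Finset.univ.filter
      (fun σ => MS2001Sec42.permWeight m w σ = MS2001Sec42.minPermWeight m w),
    MS2001Sec42.permTerm m R σ

open MS2001Sec42

omit w in
/-- The Leibniz expansion of the generic determinant in terms of `permTerm`. [folklore] -/
private theorem detPoly_eq_sum_permTerm :
    detPoly (Fin m) R = ∑ σ : Equiv.Perm (Fin m), permTerm m R σ := by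
  rw [detPoly, Matrix.det_apply']
  refine Finset.sum_congr rfl fun σ _ => ?_
  simp only [permTerm, Matrix.mvPolynomialX_apply]

/-- Base change of a permutation term. [folklore] -/
private theorem map_permTerm {S : Type*} [CommRing S] (f : R →+* S) (σ : Equiv.Perm (Fin m)) :
    MvPolynomial.map f (permTerm m R σ) = permTerm m S σ := by
  rw [permTerm, permTerm, map_mul, map_intCast, map_prod]
  congr 1
  exact Finset.prod_congr rfl fun i _ => map_X f _

/-- `W₀ ≤ wt(σ)`. [folklore] -/
private theorem minPermWeight_le (σ : Equiv.Perm (Fin m)) :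
    minPermWeight m w ≤ permWeight m w σ :=
  Finset.inf'_le _ (Finset.mem_univ σ)

variable {R}

/-- A diagonal substitution scales each variable. [folklore] -/
private theorem linSubst_diagonal_X' {k : Type u} [Field k] {σ : Type*} [Fintype σ]
    [DecidableEq σ] (d : σ → k) (v : σ) :
    linSubst σ k (Matrix.diagonal d) (X v) = d v • X v := by
  rw [linSubst_X, Finset.sum_eq_single v (fun j _ hjv => by
    rw [Matrix.diagonal_apply_ne _ hjv, zero_smul]) (fun h => absurd (Finset.mem_univ v) h),
    Matrix.diagonal_apply_eq]

/-- A diagonal substitution `y_q ↦ d_q y_q` multiplies the term of `σ` by `∏_i d_{σ(i), i}`.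
[folklore] -/
private theorem linSubst_diagonal_permTerm {k : Type u} [Field k] (d : Fin m × Fin m → k)
    (σ : Equiv.Perm (Fin m)) :
    linSubst (Fin m × Fin m) k (Matrix.diagonal d) (permTerm m k σ) =
      C (∏ i, d (σ i, i)) * permTerm m k σ := by
  rw [permTerm, map_mul, map_intCast, map_prod (linSubst (Fin m × Fin m) k (Matrix.diagonal d))]
  simp_rw [linSubst_diagonal_X', smul_eq_C_mul]
  rw [Finset.prod_mul_distrib, ← map_prod C]
  ring

variable (k : Type u) [Field k]

/-- **"`D(Y) = det(α(t) Y) = t^{W₀} h(Y) +` higher order terms in `t`"** (AV p.17 L1241): under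
the one-parameter subgroup `α(t) : y_{ij} ↦ t^{w_{ij}} y_{ij}` the determinant becomes
`∑_σ t^{wt(σ)} sign(σ) ∏_i y_{σ(i), i}`. [cite: MulmuleySohoniSIAM2001, §4.2 (AV p.17, all.txt L1226–1241)] -/
theorem linSubst_weightScaling_detPoly (t : k) :
    linSubst (Fin m × Fin m) k (Matrix.diagonal fun q => t ^ w q) (detPoly (Fin m) k) =
      ∑ σ : Equiv.Perm (Fin m), C (t ^ permWeight m w σ) * permTerm m k σ := by
  rw [detPoly_eq_sum_permTerm, map_sum]
  refine Finset.sum_congr rfl fun σ _ => ?_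
  rw [linSubst_diagonal_permTerm, Finset.prod_pow_eq_pow_sum, permWeight]

/-- **GCT I §4.2: the initial form `h(Y) = lim_{t→0} t^{-W₀} det(α(t)Y)` lies in `Δ[det(Y)]`**
(AV p.18, all.txt L1249–1262), for the determinant with arbitrary entry weights `w` over every
infinite field: `∑_{wt(σ) = W₀} sign(σ) ∏_i y_{σ(i), i} ∈ Δ[det_m]`. Proof as printed: for
`t ≠ 0` the rescaled point `t^{-W₀} det(α(t)Y)` lies in the `GL`-orbit (rescale the variables of
one row by `t^{-W₀}`), the family is polynomial in `t`, and its value at `t = 0` is `h(Y)`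
(`map_eval_zero_mem_orbitClosure_of_family`). [cite: MulmuleySohoniSIAM2001, §4.2 (AV p.18, all.txt L1249–1262)] -/
theorem MS2001_sec_4_2_detInitialForm_mem_orbitClosure [Infinite k] :
    detInitialForm m w k ∈ orbitClosure (detPoly (Fin m) k) := by
  classical
  rcases Nat.eq_zero_or_pos m with hm | hm
  · -- `m = 0`: every weight is `0`, the initial form is `det` itself
    subst hm
    have h0 : ∀ σ : Equiv.Perm (Fin 0), permWeight 0 w σ = 0 := fun σ => by
      rw [permWeight]; exact Finset.sum_of_isEmpty _
    have hmin : minPermWeight 0 w = 0 :=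
      Nat.eq_zero_of_le_zero ((minPermWeight_le 0 w 1).trans (h0 1).le)
    have heq : detInitialForm 0 w k = detPoly (Fin 0) k := by
      rw [detInitialForm, detPoly_eq_sum_permTerm, Finset.filter_true_of_mem fun σ _ => by
        rw [h0, hmin]]
    rw [heq]
    exact mem_orbitClosure_self _
  · -- the polynomial family `t ↦ t^{-minPermWeight m w} det(α(t) Y)`
    set F : MvPolynomial (Fin m × Fin m) (Polynomial k) :=
      ∑ σ : Equiv.Perm (Fin m), C (Polynomial.X ^ (permWeight m w σ - minPermWeight m w)) *
        permTerm m (Polynomial k) σ with hF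
    have hFt : ∀ t : k, MvPolynomial.map (Polynomial.evalRingHom t) F =
        ∑ σ : Equiv.Perm (Fin m), C (t ^ (permWeight m w σ - minPermWeight m w)) * permTerm m k σ := by
      intro t
      rw [hF, map_sum]
      refine Finset.sum_congr rfl fun σ _ => ?_
      rw [map_mul, map_C, map_permTerm, Polynomial.coe_evalRingHom, Polynomial.eval_pow,
        Polynomial.eval_X]
    have h0 : MvPolynomial.map (Polynomial.evalRingHom 0) F = detInitialForm m w k := by
      rw [hFt, detInitialForm, ← Finset.sum_filter_add_sum_filter_not Finset.univ
        (fun σ => permWeight m w σ = minPermWeight m w)]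
      have h1 : ∑ σ ∈ Finset.univ.filter (fun σ => permWeight m w σ = minPermWeight m w),
          C ((0 : k) ^ (permWeight m w σ - minPermWeight m w)) * permTerm m k σ =
          ∑ σ ∈ Finset.univ.filter (fun σ => permWeight m w σ = minPermWeight m w), permTerm m k σ := by
        refine Finset.sum_congr rfl fun σ hσ => ?_
        rw [(Finset.mem_filter.1 hσ).2, Nat.sub_self, pow_zero, C_1, one_mul]
      have h2 : ∑ σ ∈ Finset.univ.filter (fun σ => ¬ permWeight m w σ = minPermWeight m w),
          C ((0 : k) ^ (permWeight m w σ - minPermWeight m w)) * permTerm m k σ = 0 := by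
        refine Finset.sum_eq_zero fun σ hσ => ?_
        have hne : permWeight m w σ - minPermWeight m w ≠ 0 := by
          have := minPermWeight_le m w σ
          have h' := (Finset.mem_filter.1 hσ).2
          omega
        rw [zero_pow hne, C_0, zero_mul]
      rw [h1, h2, add_zero]
    rw [← h0]
    refine map_eval_zero_mem_orbitClosure_of_family F fun t ht => ?_
    -- for `t ≠ 0`: the row-rescaled weight scaling `β(t)`
    let r : Fin m := ⟨0, hm⟩
    let d : Fin m × Fin m → k := fun q => t ^ w q * if q.1 = r then (t ^ minPermWeight m w)⁻¹ else 1
    have hd : ∀ q, d q ≠ 0 := fun q => mul_ne_zero (pow_ne_zero _ ht) (by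
      split_ifs
      · exact inv_ne_zero (pow_ne_zero _ ht)
      · exact one_ne_zero)
    have hdet : (Matrix.diagonal d).det ≠ 0 := by
      rw [Matrix.det_diagonal]
      exact Finset.prod_ne_zero_iff.2 fun q _ => hd q
    refine ⟨Matrix.GeneralLinearGroup.mkOfDetNeZero _ hdet, ?_⟩
    show linSubstRep (Fin m × Fin m) k (Matrix.GeneralLinearGroup.mkOfDetNeZero _ hdet)
      (detPoly (Fin m) k) = _
    rw [linSubstRep_apply, hFt]
    show linSubst (Fin m × Fin m) k (Matrix.diagonal d) (detPoly (Fin m) k) = _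
    rw [detPoly_eq_sum_permTerm, map_sum]
    refine Finset.sum_congr rfl fun σ _ => ?_
    rw [linSubst_diagonal_permTerm]
    congr 2
    -- `∏_i d_{σ(i), i} = t^{wt σ} · t^{-minPermWeight m w}`
    have hsplit : ∏ i, d (σ i, i) =
        (∏ i, t ^ w (σ i, i)) * ∏ i : Fin m, (if σ i = r then (t ^ minPermWeight m w)⁻¹ else (1 : k)) := by
      rw [← Finset.prod_mul_distrib]
    rw [hsplit, Finset.prod_pow_eq_pow_sum,
      Finset.prod_eq_single (σ.symm r) (fun i _ hi => if_neg fun h => hi (by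
        rw [← h, Equiv.symm_apply_apply])) (fun h => absurd (Finset.mem_univ _) h),
      if_pos (Equiv.apply_symm_apply σ r), ← permWeight,
      pow_sub₀ _ ht (minPermWeight_le m w σ)]

end InitialForm

end Literature.Computability.AlgebraicComplexity
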